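import Summits.QuantumAdvantage.QuantumAdvantage.Theorems.CharDialWeightedTransfer
import HarnessLib

/-!
# Cell qa-qnc0 / decomp-qadv (odd primes): the UNREAD twisted correlation bound, part 2/2 — conditioning on public bits

TREE-READY PART of the node `HOME/decomp-qadv-lens-6/g9/PeelDial.lean` (decomp-qadv-lens-6 g9, §12–§13), ZERO `def … : Prop`.

**`unread_corr_win_le`** (the analytic heart of the PeelDial hybrid law; generalises the tree's `twistBound` /
`TwistedTransfer.corr_win_le` from OBLIVIOUS strategies to adaptive strategies BLIND to a set `P` of input bits):
for a prime `p`, `0 ≤ ρ` with the per-site input `∀ a ≠ 0, ∀ v, cnsq (twAvg (stdAddChar a) v) ≤ ρ²·cnsq v` (the tree's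
`TwoModuli.sum_norm_sq_twistStep_three_le` gives `ρ = cos(π/(3p))` for `p ≠ 3`, exactly as in `twistBound`), any `c`,
any strategy `y : Fin (n+1) → (Fin n → Bool) → Bool` such that NO cut depends on the bits in `P`
(`hblind : (∀ i ∉ P, u i = v i) → y g u = y g v`), and coefficients `β` with `β i ≠ 0` on `P`:

    ‖ Σ_u [ringWinU c y u] · e_p(Σ_{i : u i} β i) ‖ ≤ 3 · ρ^{|P|} · 2ⁿ.

Proof (§12–§13): insert `1 = 2^{−|P|} Σ_π [u = π off P]` (`sum_agree_indicator`, a `Fintype.piFinset` count); on each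
fibre the strategy coincides with a CONSTANT strategy (`ringWinU_congr`), whose win indicator is `(sgnU_∅ − sgnU_Y)/2`
with `sgnU = Σ_τ Π_j f^τ_j(state_j)` (tree `ConstBells.sgnU_eq_sum`); the fibre sum is a weighted path sum (part 1,
weights `siteW` = agreement indicator × phase off `P`, `(1, e_p(β_i))` on `P`), bounded through `siteB` (`1` off `P`,
`2ρ` on `P`): `norm_TBW_le`, `norm_sum_agree_sgnU_char_le ≤ 3(2ρ)^{|P|}`, `norm_sum_agree_win_le`; summing the `2ⁿ`
fibre representatives and dividing by `2^{|P|}` gives the claim.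
-/

noncomputable section

namespace Summit.QuantumAdvantage.AdviceFreeQNC0.UnreadTwist

open Finset Summit.QuantumAdvantage.AdviceFreeQNC0 TwistedTransfer ConstBells

/-! ### §12 Conditioning on the bits outside `P`: site weights -/

section Site

variable {n : ℕ} {p : ℕ} [Fact p.Prime]

/-- Site weights for the conditioned twisted sum: bits outside `P` are pinned to `π` (indicator weight), every set bit
carries its phase `e_p(β_i)`; beyond the input length the weight is `1`. -/
def siteW (β : Fin n → ZMod p) (P : Finset (Fin n)) (π : Fin n → Bool) (i : ℕ) (b : Bool) : ℂ :=
  (if h : i < n then (if (⟨i, h⟩ : Fin n) ∈ P ∨ π ⟨i, h⟩ = b then 1 else 0) else 1) * (if b then phase β i else 1)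

/-- CharDial sub-characteristic helper `siteW_val` (lens-6 g8 LAND package; see the module docstring). -/
theorem siteW_val (β : Fin n → ZMod p) (P : Finset (Fin n)) (π : Fin n → Bool) (j : Fin n) (b : Bool) :
    siteW β P π j.val b = (if j ∈ P ∨ π j = b then 1 else 0) * (if b then phase β j.val else 1) := by
  unfold siteW
  rw [dif_pos j.isLt]

/-- The product of the site weights of an input = agreement indicator × linear phase. -/
theorem prod_siteW (β : Fin n → ZMod p) (P : Finset (Fin n)) (π u : Fin n → Bool) :
    (∏ i : Fin n, siteW β P π i.val (u i)) =
      (if (∀ i : Fin n, i ∉ P → u i = π i) then (1 : ℂ) else 0) * ∏ i : Fin n, (if u i then phase β i.val else 1) := by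
  simp_rw [siteW_val]
  rw [Finset.prod_mul_distrib, Finset.prod_boole]
  by_cases hu : ∀ i : Fin n, i ∉ P → u i = π i
  · rw [if_pos hu, if_pos]
    intro i _
    by_cases hi : i ∈ P
    · exact Or.inl hi
    · exact Or.inr (hu i hi).symm
  · rw [if_neg hu, if_neg]
    intro h
    exact hu fun i hi => ((h i (Finset.mem_univ i)).resolve_left hi).symm

/-- Per-site norm factors: `2ρ` on `P`, `1` off `P`, `2` beyond the input length (never used). -/
def siteB (n : ℕ) (P : Finset (Fin n)) (ρ : ℝ) (i : ℕ) : ℝ :=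
  if h : i < n then (if (⟨i, h⟩ : Fin n) ∈ P then 2 * ρ else 1) else 2

/-- `Π_{i<n} siteB² = (4ρ²)^{|P|}`. -/
theorem prod_siteB_sq (P : Finset (Fin n)) (ρ : ℝ) :
    (∏ i ∈ range n, siteB n P ρ (0 + i) ^ 2) = ((2 * ρ) ^ 2) ^ P.card := by
  classical
  simp only [zero_add]
  rw [← Fin.prod_univ_eq_prod_range (fun i => siteB n P ρ i ^ 2) n]
  have h : ∀ i : Fin n, siteB n P ρ i.val ^ 2 = if i ∈ P then (2 * ρ) ^ 2 else 1 := by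
    intro i
    unfold siteB
    rw [dif_pos i.isLt]
    by_cases hb : i ∈ P
    · rw [if_pos hb, if_pos hb]
    · rw [if_neg hb, if_neg hb, one_pow]
  rw [Finset.prod_congr rfl (fun i _ => h i), Finset.prod_ite, Finset.prod_const, Finset.prod_const_one, mul_one]
  congr 1
  rw [Finset.filter_mem_eq_inter, Finset.univ_inter]

/-- The per-site contraction of the conditioned weights. -/
theorem cnsq_stepW_siteW_le {ρ : ℝ}
    (hsite : ∀ a : ZMod p, a ≠ 0 → ∀ v : ZMod 3 → ℂ, cnsq (twAvg (ZMod.stdAddChar a) v) ≤ ρ ^ 2 * cnsq v)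
    (β : Fin n → ZMod p) (P : Finset (Fin n)) (hP : ∀ i ∈ P, β i ≠ 0) (π : Fin n → Bool) (g : ℕ)
    (v : ZMod 3 → ℂ) : cnsq (stepW (siteW β P π g) v) ≤ siteB n P ρ g ^ 2 * cnsq v := by
  have hphase1 : ∀ i, ‖phase β i‖ ≤ 1 := by
    intro i
    unfold phase
    by_cases hi : i < n
    · rw [dif_pos hi, show (ZMod.stdAddChar (β ⟨i, hi⟩) : ℂ) = (ZMod.toCircle (β ⟨i, hi⟩) : ℂ) from rfl,
        Circle.norm_coe]
    · rw [dif_neg hi]; simp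
  unfold siteB
  by_cases hg : g < n
  · rw [dif_pos hg]
    by_cases hP' : (⟨g, hg⟩ : Fin n) ∈ P
    · -- a private site: weight `(1, e_p(β_g))` with `β_g ≠ 0`
      rw [if_pos hP']
      have h0 : siteW β P π g false = 1 := by
        unfold siteW; rw [dif_pos hg, if_pos (Or.inl hP')]; simp
      have h1 : siteW β P π g true = (ZMod.stdAddChar (β ⟨g, hg⟩) : ℂ) := by
        unfold siteW phase; rw [dif_pos hg, if_pos (Or.inl hP'), dif_pos hg]; simp
      rw [cnsq_stepW_of_false_one h0, h1]
      have := hsite _ (hP _ hP') v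
      nlinarith [cnsq_nonneg v]
    · -- a public site: a deterministic shift
      rw [if_neg hP', one_pow, one_mul]
      cases hπ : π ⟨g, hg⟩
      · have h1 : siteW β P π g true = 0 := by
          unfold siteW; rw [dif_pos hg, if_neg (by simp [hP', hπ])]; simp
        have h0 : ‖siteW β P π g false‖ ≤ 1 := by
          unfold siteW; rw [dif_pos hg, if_pos (Or.inr hπ)]; simp
        exact cnsq_stepW_of_true_zero h1 h0 v
      · have h0 : siteW β P π g false = 0 := by
          unfold siteW; rw [dif_pos hg, if_neg (by simp [hP', hπ])]; simp
        have h1 : ‖siteW β P π g true‖ ≤ 1 := by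
          unfold siteW; rw [dif_pos hg, if_pos (Or.inr hπ)]; simpa using hphase1 g
        exact cnsq_stepW_of_false_zero h0 h1 v
  · rw [dif_neg hg]
    have h0 : siteW β P π g false = 1 := by unfold siteW; rw [dif_neg hg]; simp
    have h1 : siteW β P π g true = 1 := by unfold siteW phase; rw [dif_neg hg, dif_neg hg]; simp
    rw [cnsq_stepW_of_false_one h0, h1]
    have := cnsq_twAvg_le (ζ := (1 : ℂ)) (by simp) v
    nlinarith [cnsq_nonneg v]

/-- **The conditioned twisted sum of a constant strategy in transfer form.** -/
theorem sum_agree_sgnU_char (c : ℕ) (B : Finset (Fin (n + 1))) (β : Fin n → ZMod p) (P : Finset (Fin n))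
    (π : Fin n → Bool) :
    (∑ u : Fin n → Bool, (if (∀ i : Fin n, i ∉ P → u i = π i) then (1 : ℂ) else 0) *
        ((sgnU c B u : ℂ) * ∏ i : Fin n, (if u i then phase β i.val else 1))) =
      ∑ τ : ZMod 3, TBW (siteW β P π) (fT (bellsN B) n (((c + 2 * n : ℕ) : ZMod 3)) τ) 0 n 0 := by
  have h : ∀ u : Fin n → Bool, (if (∀ i : Fin n, i ∉ P → u i = π i) then (1 : ℂ) else 0) *
      ((sgnU c B u : ℂ) * ∏ i : Fin n, (if u i then phase β i.val else 1)) =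
      ∑ τ : ZMod 3, ((∏ j ∈ range (n + 1), fT (bellsN B) n (((c + 2 * n : ℕ) : ZMod 3)) τ (0 + j)
        (0 + ((j + wtPrefix u j : ℕ) : ZMod 3)) : ℝ) : ℂ) * ∏ i : Fin n, siteW β P π (0 + i.val) (u i) := by
    intro u
    simp only [zero_add]
    rw [prod_siteW, sgnU_eq_sum, Complex.ofReal_sum, Finset.sum_mul]
    have : ∀ τ : ZMod 3, ((∏ j ∈ range (n + 1), fT (bellsN B) n (((c + 2 * n : ℕ) : ZMod 3)) τ j (st u j) : ℝ) : ℂ) *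
        ((if (∀ i : Fin n, i ∉ P → u i = π i) then (1 : ℂ) else 0) * ∏ i : Fin n, (if u i then phase β i.val else 1)) =
        (if (∀ i : Fin n, i ∉ P → u i = π i) then (1 : ℂ) else 0) *
          (((∏ j ∈ range (n + 1), fT (bellsN B) n (((c + 2 * n : ℕ) : ZMod 3)) τ j (st u j) : ℝ) : ℂ) *
            ∏ i : Fin n, (if u i then phase β i.val else 1)) := fun τ => by ring
    rw [Finset.mul_sum]
    refine Finset.sum_congr rfl fun τ _ => ?_
    rw [← this τ]
    rfl
  simp_rw [h]
  rw [Finset.sum_comm]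
  refine Finset.sum_congr rfl fun τ _ => ?_
  exact weighted_pathSum_eq (siteW β P π) _ n 0 0

/-- The bound on one conditioned transfer vector: `|TBW_0(0)| ≤ (2ρ)^{|P|}`. -/
theorem norm_TBW_le {ρ : ℝ} (hρ : 0 ≤ ρ)
    (hsite : ∀ a : ZMod p, a ≠ 0 → ∀ v : ZMod 3 → ℂ, cnsq (twAvg (ZMod.stdAddChar a) v) ≤ ρ ^ 2 * cnsq v)
    (β : Fin n → ZMod p) (P : Finset (Fin n)) (hP : ∀ i ∈ P, β i ≠ 0) (π : Fin n → Bool)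
    (BN : Finset ℕ) (κ τ : ZMod 3) :
    ‖TBW (siteW β P π) (fT BN n κ τ) 0 n 0‖ ≤ (2 * ρ) ^ P.card := by
  have h1 := cnsq_TBW_le (siteW β P π) (fT BN n κ τ) (fT_sq_le BN n κ τ) (siteB n P ρ)
    (cnsq_stepW_siteW_le hsite β P hP π) n 0
  rw [prod_siteB_sq, zero_add, TBW_zero, cnsq_ofReal] at h1
  have h2 : cnsq (TBW (siteW β P π) (fT BN n κ τ) 0 n) ≤ ((2 * ρ) ^ 2) ^ P.card := by
    refine h1.trans ?_
    have := nsq_fT_last BN n κ τ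
    have h0 : 0 ≤ ((2 * ρ) ^ 2) ^ P.card := by positivity
    nlinarith
  have hsq : ((2 * ρ) ^ 2) ^ P.card = ((2 * ρ) ^ P.card) ^ 2 := by rw [← pow_mul, ← pow_mul, Nat.mul_comm]
  have h3 : ‖TBW (siteW β P π) (fT BN n κ τ) 0 n 0‖ ^ 2 ≤ ((2 * ρ) ^ P.card) ^ 2 := by
    rw [← hsq]
    exact (normSq_le_cnsq _ 0).trans h2
  have h4 := abs_le_of_sq_le_sq h3 (by positivity)
  rwa [abs_norm] at h4

/-- The conditioned twisted sum of a constant strategy is small: `≤ 3·(2ρ)^{|P|}`. -/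
theorem norm_sum_agree_sgnU_char_le {ρ : ℝ} (hρ : 0 ≤ ρ)
    (hsite : ∀ a : ZMod p, a ≠ 0 → ∀ v : ZMod 3 → ℂ, cnsq (twAvg (ZMod.stdAddChar a) v) ≤ ρ ^ 2 * cnsq v)
    (c : ℕ) (B : Finset (Fin (n + 1))) (β : Fin n → ZMod p) (P : Finset (Fin n)) (hP : ∀ i ∈ P, β i ≠ 0)
    (π : Fin n → Bool) :
    ‖∑ u : Fin n → Bool, (if (∀ i : Fin n, i ∉ P → u i = π i) then (1 : ℂ) else 0) *
        ((sgnU c B u : ℂ) * ∏ i : Fin n, (if u i then phase β i.val else 1))‖ ≤ 3 * (2 * ρ) ^ P.card := by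
  rw [sum_agree_sgnU_char]
  have hτ : ∀ τ : ZMod 3, ‖TBW (siteW β P π) (fT (bellsN B) n (((c + 2 * n : ℕ) : ZMod 3)) τ) 0 n 0‖ ≤
      (2 * ρ) ^ P.card := fun τ => norm_TBW_le hρ hsite β P hP π _ _ τ
  have h3 : (∑ τ : ZMod 3, ‖TBW (siteW β P π) (fT (bellsN B) n (((c + 2 * n : ℕ) : ZMod 3)) τ) 0 n 0‖) =
      ‖TBW (siteW β P π) (fT (bellsN B) n (((c + 2 * n : ℕ) : ZMod 3)) 0) 0 n 0‖ +
      ‖TBW (siteW β P π) (fT (bellsN B) n (((c + 2 * n : ℕ) : ZMod 3)) 1) 0 n 0‖ +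
      ‖TBW (siteW β P π) (fT (bellsN B) n (((c + 2 * n : ℕ) : ZMod 3)) 2) 0 n 0‖ := Fin.sum_univ_three _
  refine (norm_sum_le _ _).trans ?_
  rw [h3]
  have t0 := hτ 0; have t1 := hτ 1; have t2 := hτ 2
  linarith

/-- The conditioned twisted WIN sum of a constant strategy is small: `≤ 3·(2ρ)^{|P|}`. -/
theorem norm_sum_agree_win_le {ρ : ℝ} (hρ : 0 ≤ ρ)
    (hsite : ∀ a : ZMod p, a ≠ 0 → ∀ v : ZMod 3 → ℂ, cnsq (twAvg (ZMod.stdAddChar a) v) ≤ ρ ^ 2 * cnsq v)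
    (c : ℕ) (Y : Finset (Fin (n + 1))) (β : Fin n → ZMod p) (P : Finset (Fin n)) (hP : ∀ i ∈ P, β i ≠ 0)
    (π : Fin n → Bool) :
    ‖∑ u : Fin n → Bool, (if (∀ i : Fin n, i ∉ P → u i = π i) then (1 : ℂ) else 0) *
        ((if ringWinU c (fun g _ => decide (g ∈ Y)) u = true then (1 : ℂ) else 0) *
          (ZMod.stdAddChar (∑ i : Fin n, if u i then β i else 0) : ℂ))‖ ≤ 3 * (2 * ρ) ^ P.card := by
  have hterm : ∀ u : Fin n → Bool, (if (∀ i : Fin n, i ∉ P → u i = π i) then (1 : ℂ) else 0) *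
      ((if ringWinU c (fun g _ => decide (g ∈ Y)) u = true then (1 : ℂ) else 0) *
        (ZMod.stdAddChar (∑ i : Fin n, if u i then β i else 0) : ℂ)) =
      (1 / 2) * ((if (∀ i : Fin n, i ∉ P → u i = π i) then (1 : ℂ) else 0) *
        ((sgnU c (∅ : Finset (Fin (n + 1))) u : ℂ) * ∏ i : Fin n, (if u i then phase β i.val else 1))) -
      (1 / 2) * ((if (∀ i : Fin n, i ∉ P → u i = π i) then (1 : ℂ) else 0) *
        ((sgnU c Y u : ℂ) * ∏ i : Fin n, (if u i then phase β i.val else 1))) := by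
    intro u
    rw [win_indicator_eq, char_eq_prod, sgnU_empty]
    push_cast; ring
  simp_rw [hterm]
  rw [Finset.sum_sub_distrib, ← Finset.mul_sum, ← Finset.mul_sum]
  have hA := norm_sum_agree_sgnU_char_le hρ hsite c (∅ : Finset (Fin (n + 1))) β P hP π
  have hB := norm_sum_agree_sgnU_char_le hρ hsite c Y β P hP π
  refine (norm_sub_le _ _).trans ?_
  rw [norm_mul, norm_mul, show ‖(1 / 2 : ℂ)‖ = 1 / 2 from by norm_num]
  linarith

/-! ### §13 Strategies BLIND to `P`: the unread twisted correlation bound -/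

/-- The number of assignments agreeing with `u` outside `P` is `2^{|P|}`. -/
theorem sum_agree_indicator (P : Finset (Fin n)) (u : Fin n → Bool) :
    (∑ π : Fin n → Bool, (if (∀ i : Fin n, i ∉ P → u i = π i) then (1 : ℂ) else 0)) = (2 : ℂ) ^ P.card := by
  classical
  rw [Finset.sum_boole]
  have hset : (Finset.univ.filter fun π : Fin n → Bool => ∀ i : Fin n, i ∉ P → u i = π i) =
      Fintype.piFinset fun i : Fin n => if i ∈ P then (Finset.univ : Finset Bool) else {u i} := by
    ext π
    simp only [Finset.mem_filter, Finset.mem_univ, true_and, Fintype.mem_piFinset]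
    constructor
    · intro h i
      by_cases hi : i ∈ P
      · rw [if_pos hi]; exact Finset.mem_univ _
      · rw [if_neg hi, Finset.mem_singleton, h i hi]
    · intro h i hi
      have := h i
      rw [if_neg hi, Finset.mem_singleton] at this
      exact this.symm
  rw [hset, Fintype.card_piFinset]
  have h : ∀ i : Fin n, ((if i ∈ P then (Finset.univ : Finset Bool) else {u i}).card : ℂ) =
      if i ∈ P then 2 else 1 := by
    intro i
    by_cases hi : i ∈ P
    · rw [if_pos hi, if_pos hi, Finset.card_univ, Fintype.card_bool]; norm_num
    · rw [if_neg hi, if_neg hi, Finset.card_singleton]; norm_num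
  push_cast
  rw [Finset.prod_congr rfl (fun i _ => h i), Finset.prod_ite, Finset.prod_const, Finset.prod_const_one, mul_one,
    Finset.filter_mem_eq_inter, Finset.univ_inter]

/-- The win bit depends on the strategy only through its answers at the given input. -/
theorem ringWinU_congr {c : ℕ} {y y' : Fin (n + 1) → (Fin n → Bool) → Bool} {u : Fin n → Bool}
    (h : ∀ g, y g u = y' g u) : ringWinU c y u = ringWinU c y' u := by
  unfold ringWinU
  simp_rw [h]

/-- **Unread twisted correlation bound.**  If no cut of the strategy `y` reads a bit of `P`, and the phase vector `β` is
nonzero on `P`, then `|Σ_u [win_y(u)]·e_p(Σ_{i : u_i} β_i)| ≤ 3·ρ^{|P|}·2ⁿ` — the tree's `TwistBound` (oblivious `y`)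
generalised to strategies blind to `P`, by conditioning on the bits outside `P`. -/
theorem unread_corr_win_le {ρ : ℝ} (hρ : 0 ≤ ρ)
    (hsite : ∀ a : ZMod p, a ≠ 0 → ∀ v : ZMod 3 → ℂ, cnsq (twAvg (ZMod.stdAddChar a) v) ≤ ρ ^ 2 * cnsq v)
    (c : ℕ) (y : Fin (n + 1) → (Fin n → Bool) → Bool) (β : Fin n → ZMod p) (P : Finset (Fin n))
    (hP : ∀ i ∈ P, β i ≠ 0) (hblind : ∀ g (u v : Fin n → Bool), (∀ i : Fin n, i ∉ P → u i = v i) → y g u = y g v) :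
    ‖∑ u : Fin n → Bool, (if ringWinU c y u = true then (1 : ℂ) else 0) *
        (ZMod.stdAddChar (∑ i : Fin n, if u i then β i else 0) : ℂ)‖ ≤ 3 * ρ ^ P.card * (2 : ℝ) ^ n := by
  classical
  set F : (Fin n → Bool) → ℂ := fun u => (if ringWinU c y u = true then (1 : ℂ) else 0) *
    (ZMod.stdAddChar (∑ i : Fin n, if u i then β i else 0) : ℂ) with hF
  -- insert the agreement indicators
  have h2P : (2 : ℂ) ^ P.card ≠ 0 := pow_ne_zero _ two_ne_zero
  have hins : (∑ u : Fin n → Bool, F u) = ((2 : ℂ) ^ P.card)⁻¹ *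
      ∑ π : Fin n → Bool, ∑ u : Fin n → Bool, (if (∀ i : Fin n, i ∉ P → u i = π i) then (1 : ℂ) else 0) * F u := by
    rw [Finset.sum_comm]
    have : ∀ u : Fin n → Bool, (∑ π : Fin n → Bool, (if (∀ i : Fin n, i ∉ P → u i = π i) then (1 : ℂ) else 0) * F u) =
        (2 : ℂ) ^ P.card * F u := by
      intro u
      rw [← Finset.sum_mul, sum_agree_indicator]
    simp_rw [this]
    rw [← Finset.mul_sum, ← mul_assoc, inv_mul_cancel₀ h2P, one_mul]
  -- for a fixed `π` the strategy is the constant strategy `Y_π`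
  have hπ : ∀ π : Fin n → Bool,
      ‖∑ u : Fin n → Bool, (if (∀ i : Fin n, i ∉ P → u i = π i) then (1 : ℂ) else 0) * F u‖ ≤ 3 * (2 * ρ) ^ P.card := by
    intro π
    set Y : Finset (Fin (n + 1)) := Finset.univ.filter fun g => y g π = true with hY
    have hterm : ∀ u : Fin n → Bool, (if (∀ i : Fin n, i ∉ P → u i = π i) then (1 : ℂ) else 0) * F u =
        (if (∀ i : Fin n, i ∉ P → u i = π i) then (1 : ℂ) else 0) *
          ((if ringWinU c (fun g _ => decide (g ∈ Y)) u = true then (1 : ℂ) else 0) *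
            (ZMod.stdAddChar (∑ i : Fin n, if u i then β i else 0) : ℂ)) := by
      intro u
      by_cases hu : ∀ i : Fin n, i ∉ P → u i = π i
      · rw [if_pos hu, hF]
        simp only
        have hw : ringWinU c y u = ringWinU c (fun g _ => decide (g ∈ Y)) u := by
          refine ringWinU_congr fun g => ?_
          rw [hY]
          simp only [Finset.mem_filter, Finset.mem_univ, true_and, Bool.decide_eq_true]
          exact hblind g u π hu
        rw [hw]
      · rw [if_neg hu, zero_mul, zero_mul]
    simp_rw [hterm]
    exact norm_sum_agree_win_le hρ hsite c Y β P hP π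
  rw [hins, norm_mul, norm_inv, norm_pow, Complex.norm_ofNat]
  have hsum : ‖∑ π : Fin n → Bool, ∑ u : Fin n → Bool,
      (if (∀ i : Fin n, i ∉ P → u i = π i) then (1 : ℂ) else 0) * F u‖ ≤ (2 : ℝ) ^ n * (3 * (2 * ρ) ^ P.card) := by
    refine (norm_sum_le _ _).trans ?_
    have : (∑ π : Fin n → Bool, (3 * (2 * ρ) ^ P.card : ℝ)) = (2 : ℝ) ^ n * (3 * (2 * ρ) ^ P.card) := by
      rw [Finset.sum_const, Finset.card_univ, Fintype.card_fun, Fintype.card_bool, Fintype.card_fin, nsmul_eq_mul]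
      push_cast; ring
    rw [← this]
    exact Finset.sum_le_sum fun π _ => hπ π
  have h2 : 0 < (2 : ℝ) ^ P.card := by positivity
  calc ((2 : ℝ) ^ P.card)⁻¹ * ‖∑ π : Fin n → Bool, ∑ u : Fin n → Bool,
        (if (∀ i : Fin n, i ∉ P → u i = π i) then (1 : ℂ) else 0) * F u‖
      ≤ ((2 : ℝ) ^ P.card)⁻¹ * ((2 : ℝ) ^ n * (3 * (2 * ρ) ^ P.card)) :=
        mul_le_mul_of_nonneg_left hsum (by positivity)
    _ = 3 * ρ ^ P.card * (2 : ℝ) ^ n := by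
        rw [mul_pow]
        field_simp

end Site

end Summit.QuantumAdvantage.AdviceFreeQNC0.UnreadTwist

end
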